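import Literature.Probability.Percolation.KozmaNitzanLemma3iCluster
import HarnessLib

/-!
# `NoHeavyLowerTail` (stmt-CriticalPhenomena-4575) — the star rows of the one-layer floor-split CIL

Helper file of lemma factory #5 (`prim-lf-5`, gen 10; memo `run/shared/lean/prim/prim-lf-5/FSCIL-ONELAYER-PROOF.md`,
Step 2).  `--supports stmt-CriticalPhenomena-4575`.  No definitions, no named facts, no sorries.

For a monotone predicate `P` on vertex sets ("big"), vertices `c, v` and a vertex set `B` (a "star": the relays
an observer is glued to), write `X_x = {P(C(x))}`, `C(B) = ⋃_{b ∈ B} C(b)`, `{v ↔ B} = {∃ u ∈ B, v ↔ u}`.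
**The star row**: if `c` is lighter than `v` (`P(X_c) ≤ P(X_v)`) and lighter than some `b ∈ B`, then

  `P(X_c) ≤ P(X_v, v ↔ B) + P(P(C(B)), v ↮ B)`,

i.e. `c` is lighter than the RANDOM target "`C(v)` if `v ↔ B`, else `C(B)`" (a non-monotone event).  Proof: if `v`
is lighter than some `b ∈ B`, Kozma–Nitzan's Lemma 3(ii) (cluster form, `Q = {v ↮ B}`) gives
`P(X_v, v ↮ B) ≤ P(X_b, v ↮ B) ≤ P(P(C(B)), v ↮ B)`; otherwise the `b₀ ∈ B` that `c` is lighter than is lighter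
than `v`, and Lemma 3(i) (cluster form, `Q = {v ↔ B}` increasing in `C(v)`) gives
`P(X_{b₀}, v ↔ B) ≤ P(X_v, v ↔ B)`, while `X_{b₀} ⊆ {P(C(B))}`.  With `v = c` this is Kozma–Nitzan's Lemma 5
(the tree's `localizedLightnessTransfer`); the complemented ("small") form `starRow_small` is the shape used by
the per-star identity of the one-layer floor-split inequality.
-/

noncomputable section

namespace Summit.CriticalPhenomena.PercolationContinuityZ3.Theorems

open MeasureTheory Set Literature.Probability.LatticeModels Literature.Probability.Percolation
open scoped Classical

variable {V : Type*}

namespace FloorSplitOneLayer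

/-- `X_b ⊆ {P(C(B))}` for `b ∈ B` and `P` monotone: the cluster of `b` is part of the cluster of the set `B`.
[this work] -/
theorem setOf_prop_subset_biUnion (P : Set V → Prop) (hP : ∀ S T : Set V, S ⊆ T → P S → P T)
    {B : Set V} {b : V} (hb : b ∈ B) :
    {ω : BondConfig V | P (openCluster ω b)} ⊆ {ω | P (⋃ u ∈ B, openCluster ω u)} :=
  fun ω hω => hP _ _ (subset_biUnion_of_mem (u := fun u => openCluster ω u) hb) hω

/-- On `{v ↔ B}`, `X_v ⊆ {P(C(B))}`: if `v ↔ u ∈ B` then `C(v) = C(u) ⊆ C(B)`. [this work] -/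
theorem setOf_prop_inter_conn_subset (P : Set V → Prop) (hP : ∀ S T : Set V, S ⊆ T → P S → P T)
    (B : Set V) (v : V) :
    {ω : BondConfig V | P (openCluster ω v)} ∩ {ω | ∃ u ∈ B, (openGraph ω).Reachable v u} ⊆
      {ω | P (⋃ u ∈ B, openCluster ω u)} := by
  rintro ω ⟨hω, u, hu, hvu⟩
  refine hP _ _ (fun x hx => mem_biUnion hu ?_) hω
  exact hvu.symm.trans hx

variable [Fintype V]

/-- **The star row (big form).**  For a monotone predicate `P` on vertex sets: if `P(X_c) ≤ P(X_v)` and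
`P(X_c) ≤ P(X_b)` for some `b ∈ B`, then `P(X_c) ≤ P(X_v ∩ {v ↔ B}) + P({P(C(B))} ∩ {v ↮ B})`.
Kozma–Nitzan Lemma 3(ii) (if `v` is lighter than some member of `B`) or Lemma 3(i) (otherwise), cluster forms.
[this work; cite: KozmaNitzan2024, Lemma 3 (pp. 6–7) and Lemma 5 (p. 13)] -/
theorem starRow_big (w : Sym2 V → unitInterval) (P : Set V → Prop)
    (hP : ∀ S T : Set V, S ⊆ T → P S → P T) (c v : V) (B : Set V)
    (hcv : (prodBernoulli w).real {ω | P (openCluster ω c)} ≤ (prodBernoulli w).real {ω | P (openCluster ω v)})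
    (hcB : ∃ b ∈ B, (prodBernoulli w).real {ω | P (openCluster ω c)} ≤
      (prodBernoulli w).real {ω | P (openCluster ω b)}) :
    (prodBernoulli w).real {ω | P (openCluster ω c)} ≤
      (prodBernoulli w).real ({ω | P (openCluster ω v)} ∩ {ω | ∃ u ∈ B, (openGraph ω).Reachable v u}) +
        (prodBernoulli w).real ({ω | P (⋃ u ∈ B, openCluster ω u)} ∩
          {ω | ∀ u ∈ B, ¬ (openGraph ω).Reachable v u}) := by
  set μ := prodBernoulli w with hμ
  set Xv : Set (BondConfig V) := {ω | P (openCluster ω v)} with hXv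
  set Y : Set (BondConfig V) := {ω | ∃ u ∈ B, (openGraph ω).Reachable v u} with hY
  set N : Set (BondConfig V) := {ω | ∀ u ∈ B, ¬ (openGraph ω).Reachable v u} with hN
  set CB : Set (BondConfig V) := {ω | P (⋃ u ∈ B, openCluster ω u)} with hCB
  -- splitting an event along `{v ↔ B}` / `{v ↮ B}`
  have hYN : N = Yᶜ := by
    ext ω; simp [hN, hY]
  have hsplit : ∀ E : Set (BondConfig V), μ.real E = μ.real (E ∩ Y) + μ.real (E ∩ N) := by
    intro E
    rw [hYN, ← measureReal_inter_add_sdiff (s := E) (MeasurableSet.of_discrete : MeasurableSet Y),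
      Set.sdiff_eq]
  by_cases h1 : ∃ b ∈ B, μ.real Xv ≤ μ.real {ω | P (openCluster ω b)}
  · -- `v` lighter than `b ∈ B`: Lemma 3(ii) with `Q = {v ↮ B}`
    obtain ⟨b, hb, hvb⟩ := h1
    have L := KozmaNitzan2024_lemma3_ii_cluster_notConn w v b P hP B hvb
    have hbC : μ.real ({ω | P (openCluster ω b)} ∩ N) ≤ μ.real (CB ∩ N) :=
      measureReal_mono fun ω ⟨h1, h2⟩ => ⟨setOf_prop_subset_biUnion P hP hb h1, h2⟩
    calc μ.real {ω | P (openCluster ω c)} ≤ μ.real Xv := hcv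
      _ = μ.real (Xv ∩ Y) + μ.real (Xv ∩ N) := hsplit Xv
      _ ≤ μ.real (Xv ∩ Y) + μ.real (CB ∩ N) := by linarith [L.trans hbC]
  · -- every member of `B` is heavier than `v`; `c` is lighter than `b₀ ∈ B`: Lemma 3(i) with `Q = {v ↔ B}`
    obtain ⟨b₀, hb₀, hcb₀⟩ := hcB
    push Not at h1
    have hb₀v : μ.real {ω | P (openCluster ω b₀)} ≤ μ.real Xv := (h1 b₀ hb₀).le
    have L := KozmaNitzan2024_lemma3_i_cluster_conn w b₀ v P hP B hb₀v
    have hbC : μ.real ({ω | P (openCluster ω b₀)} ∩ N) ≤ μ.real (CB ∩ N) :=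
      measureReal_mono fun ω ⟨h1, h2⟩ => ⟨setOf_prop_subset_biUnion P hP hb₀ h1, h2⟩
    calc μ.real {ω | P (openCluster ω c)} ≤ μ.real {ω | P (openCluster ω b₀)} := hcb₀
      _ = μ.real ({ω | P (openCluster ω b₀)} ∩ Y) + μ.real ({ω | P (openCluster ω b₀)} ∩ N) := hsplit _
      _ ≤ μ.real (Xv ∩ Y) + μ.real (CB ∩ N) := add_le_add L hbC

omit [Fintype V] in
/-- **The union row**: if `P(X_c) ≤ P(X_b)` for some `b ∈ B` then `P(X_c) ≤ P(P(C(B)))`. [this work] -/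
theorem unionRow_big (w : Sym2 V → unitInterval) (P : Set V → Prop)
    (hP : ∀ S T : Set V, S ⊆ T → P S → P T) (c : V) (B : Set V)
    (hcB : ∃ b ∈ B, (prodBernoulli w).real {ω | P (openCluster ω c)} ≤
      (prodBernoulli w).real {ω | P (openCluster ω b)}) :
    (prodBernoulli w).real {ω | P (openCluster ω c)} ≤
      (prodBernoulli w).real {ω | P (⋃ u ∈ B, openCluster ω u)} := by
  obtain ⟨b, hb, hcb⟩ := hcB
  exact hcb.trans (measureReal_mono (setOf_prop_subset_biUnion P hP hb))

/-- Complement bookkeeping: `μ(Eᶜ ∩ F) = μ(F) - μ(E ∩ F)`. [folklore] -/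
theorem real_compl_inter (μ : Measure (BondConfig V)) [IsFiniteMeasure μ] (E F : Set (BondConfig V)) :
    μ.real (Eᶜ ∩ F) = μ.real F - μ.real (E ∩ F) := by
  have := measureReal_inter_add_sdiff (μ := μ) (s := F) (t := E) MeasurableSet.of_discrete
  rw [Set.inter_comm F E, Set.sdiff_eq, Set.inter_comm F Eᶜ] at this
  linarith

/-- **The star row (small form)**, the shape used by the one-layer floor-split identity: under the hypotheses of
`starRow_big` read with "small" = `¬ P`, i.e. `P(v small) ≤ P(c small)` and `P(b small) ≤ P(c small)` for some
`b ∈ B`:  `P(C(B) small, v ↮ B) + P(v small, v ↔ B) ≤ P(c small)`. [this work] -/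
theorem starRow_small (w : Sym2 V → unitInterval) (P : Set V → Prop)
    (hP : ∀ S T : Set V, S ⊆ T → P S → P T) (c v : V) (B : Set V)
    (hcv : (prodBernoulli w).real {ω | ¬ P (openCluster ω v)} ≤
      (prodBernoulli w).real {ω | ¬ P (openCluster ω c)})
    (hcB : ∃ b ∈ B, (prodBernoulli w).real {ω | ¬ P (openCluster ω b)} ≤
      (prodBernoulli w).real {ω | ¬ P (openCluster ω c)}) :
    (prodBernoulli w).real ({ω | ¬ P (⋃ u ∈ B, openCluster ω u)} ∩
        {ω | ∀ u ∈ B, ¬ (openGraph ω).Reachable v u}) +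
      (prodBernoulli w).real ({ω | ¬ P (openCluster ω v)} ∩ {ω | ∃ u ∈ B, (openGraph ω).Reachable v u}) ≤
      (prodBernoulli w).real {ω | ¬ P (openCluster ω c)} := by
  set μ := prodBernoulli w with hμ
  -- pass to complements: `μ{¬P(C x)} = 1 - μ{P(C x)}`
  have hc' : ∀ x : V, μ.real {ω | ¬ P (openCluster ω x)} = 1 - μ.real {ω | P (openCluster ω x)} := by
    intro x
    rw [show {ω : BondConfig V | ¬ P (openCluster ω x)} = {ω | P (openCluster ω x)}ᶜ from rfl,
      measureReal_compl (μ := μ) MeasurableSet.of_discrete, probReal_univ]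
  have hcv' : μ.real {ω | P (openCluster ω c)} ≤ μ.real {ω | P (openCluster ω v)} := by
    have := hcv; rw [hc', hc'] at this; linarith
  have hcB' : ∃ b ∈ B, μ.real {ω | P (openCluster ω c)} ≤ μ.real {ω | P (openCluster ω b)} := by
    obtain ⟨b, hb, h⟩ := hcB
    refine ⟨b, hb, ?_⟩
    rw [hc', hc'] at h; linarith
  have big := starRow_big w P hP c v B hcv' hcB'
  set Y : Set (BondConfig V) := {ω | ∃ u ∈ B, (openGraph ω).Reachable v u} with hY
  set N : Set (BondConfig V) := {ω | ∀ u ∈ B, ¬ (openGraph ω).Reachable v u} with hN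
  have hYN : μ.real Y + μ.real N = 1 := by
    have hNc : N = Yᶜ := by ext ω; simp [hN, hY]
    rw [hNc, measureReal_compl (μ := μ) MeasurableSet.of_discrete, probReal_univ]; ring
  have e1 : μ.real ({ω | ¬ P (⋃ u ∈ B, openCluster ω u)} ∩ N) =
      μ.real N - μ.real ({ω | P (⋃ u ∈ B, openCluster ω u)} ∩ N) := real_compl_inter μ _ N
  have e2 : μ.real ({ω | ¬ P (openCluster ω v)} ∩ Y) = μ.real Y - μ.real ({ω | P (openCluster ω v)} ∩ Y) :=
    real_compl_inter μ _ Y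
  rw [e1, e2, hc' c]
  linarith

omit [Fintype V] in
/-- **The union row (small form)**: `P(C(B) small) ≤ P(c small)` if `P(b small) ≤ P(c small)` for some `b ∈ B`.
[this work] -/
theorem unionRow_small (w : Sym2 V → unitInterval) (P : Set V → Prop)
    (hP : ∀ S T : Set V, S ⊆ T → P S → P T) (c : V) (B : Set V)
    (hcB : ∃ b ∈ B, (prodBernoulli w).real {ω | ¬ P (openCluster ω b)} ≤
      (prodBernoulli w).real {ω | ¬ P (openCluster ω c)}) :
    (prodBernoulli w).real {ω | ¬ P (⋃ u ∈ B, openCluster ω u)} ≤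
      (prodBernoulli w).real {ω | ¬ P (openCluster ω c)} := by
  obtain ⟨b, hb, hcb⟩ := hcB
  refine le_trans (measureReal_mono fun ω hω h => hω (setOf_prop_subset_biUnion P hP hb h)) hcb

end FloorSplitOneLayer

end Summit.CriticalPhenomena.PercolationContinuityZ3.Theorems

end
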